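import Summits.CriticalPhenomena.Ising3DConformalLimit.Theorems.EnergyNotSigmaSquaredEnergyGapSoftRatioRegular

/-!
# Growth of a positive lattice function along a ray
(stub `stub_rayGrowth` of crux `EnergyGapPowerLaw`, item stmt-CriticalPhenomena-4469, route
`EnergyNotSigmaSquared`; the quantitative form of steps (i)–(iii) of
`ratio_le_of_lowerSecondRatio_of_ceiling` in `…EnergyGapSoftRatioRegular`)

Pure algebra.  For a positive function `F` on `ℤ³`, a lattice vector `e`, a base point `x`, a number
of steps `L`, a defect `η ∈ [0,1]` and a rate `a ≥ 0`: if `a ≤ (1 − Lη)·F(x+e)/F(x)` and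
`(1 − η)F(y)² ≤ F(y+e)F(y−e)` at the interior points `y = x + (j+1)e`, `j + 2 ≤ L`, then
`a^L F(x) ≤ F(x + Le)`.

Proof: the consecutive ratios `r_j = F(x+(j+1)e)/F(x+je)` satisfy `r_{j+1} ≥ (1−η) r_j`, hence
`r_j ≥ (1−η)^j r_0 ≥ (1 − jη) r_0 ≥ (1 − Lη) r_0 ≥ a` (Bernoulli), and telescoping gives the claim.

Nothing here asserts the item.
-/

noncomputable section

namespace Summit.CriticalPhenomena.Ising3DConformalLimit.EnergyNotSigmaSquaredEnergyGapPowerLaw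

open Literature.Probability.LatticeModels

/-- **Growth along a ray.**  For a positive lattice function `F`, a lattice vector `e`, a base point
`x`, a number of steps `L`, a defect `η ∈ [0,1]` and a rate `a ≥ 0`: if `a ≤ (1 − Lη)·F(x+e)/F(x)`
and the second ratios at the interior points `x + (j+1)e` (`j + 2 ≤ L`) satisfy
`(1 − η)F(y)² ≤ F(y+e)F(y−e)`, then `a^L F(x) ≤ F(x + L e)`: the consecutive ratios
`r_j = F(x+(j+1)e)/F(x+je)` obey `r_{j+1} ≥ (1−η) r_j`, so by Bernoulli
`r_j ≥ (1−η)^j r_0 ≥ (1 − jη) r_0 ≥ (1 − Lη) r_0 ≥ a` for `j < L`, and the product telescopes.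
[folklore] -/
theorem stub_rayGrowth :
    ∀ (F : Site 3 → ℝ) (e x : Site 3) (L : ℕ) (a η : ℝ),
      (∀ v, 0 < F v) → 0 ≤ η → η ≤ 1 → 0 ≤ a →
      a ≤ (1 - (L : ℝ) * η) * (F (x + e) / F x) →
      (∀ j : ℕ, j + 2 ≤ L →
        (1 - η) * F (x + (j + 1) • e) ^ 2 ≤ F (x + (j + 1) • e + e) * F (x + (j + 1) • e - e)) →
      a ^ L * F x ≤ F (x + L • e) := by
  intro F e x L a η hF hη0 hη1 ha hfirst hdef
  have h1η : 0 ≤ 1 - η := by linarith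
  -- consecutive ratios along the ray `x + ℕ e`
  set r : ℕ → ℝ := fun j => F (x + (j + 1) • e) / F (x + j • e) with hr_def
  have hrpos : ∀ j, 0 < r j := fun j => div_pos (hF _) (hF _)
  have hr0 : r 0 = F (x + e) / F x := by
    simp only [hr_def, zero_add, one_nsmul, zero_nsmul, add_zero]
  -- (i) consecutive ratios shrink at most by the factor `1 - η`
  have hstep : ∀ j : ℕ, j + 2 ≤ L → (1 - η) * r j ≤ r (j + 1) := by
    intro j hj
    have hy := hdef j hj
    have hsub : x + (j + 1) • e - e = x + j • e := by
      rw [succ_nsmul, ← add_assoc, add_sub_cancel_right]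
    have hadd : x + (j + 1) • e + e = x + (j + 1 + 1) • e := by
      rw [succ_nsmul e (j + 1), add_assoc]
    rw [hsub, hadd] at hy
    show (1 - η) * (F (x + (j + 1) • e) / F (x + j • e)) ≤
      F (x + (j + 1 + 1) • e) / F (x + (j + 1) • e)
    rw [mul_div_assoc', div_le_div_iff₀ (hF _) (hF _)]
    nlinarith [hF (x + (j + 1) • e), hF (x + j • e)]
  -- (ii) hence they stay above `(1 - η)^j · r 0`
  have hdecay : ∀ j : ℕ, j + 1 ≤ L → (1 - η) ^ j * r 0 ≤ r j := by
    intro j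
    induction j with
    | zero => intro _; rw [pow_zero, one_mul]
    | succ j ih =>
      intro hj
      have ih' := ih (by omega)
      calc (1 - η) ^ (j + 1) * r 0 = (1 - η) * ((1 - η) ^ j * r 0) := by ring
        _ ≤ (1 - η) * r j := mul_le_mul_of_nonneg_left ih' h1η
        _ ≤ r (j + 1) := hstep j (by omega)
  -- (iii) and above `a`, by Bernoulli `1 - jη ≤ (1 - η)^j` and `1 - Lη ≤ 1 - jη`
  have hge : ∀ j : ℕ, j + 1 ≤ L → a ≤ r j := by
    intro j hj
    have hbern : 1 + (j : ℝ) * (-η) ≤ (1 + (-η)) ^ j := one_add_mul_le_pow (by linarith) j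
    have h1 : (1 : ℝ) + j * -η = 1 - j * η := by ring
    have h2 : (1 : ℝ) + -η = 1 - η := by ring
    rw [h1, h2] at hbern
    have hjL : (j : ℝ) ≤ L := by exact_mod_cast (by omega : j ≤ L)
    have hjLη : (j : ℝ) * η ≤ L * η := mul_le_mul_of_nonneg_right hjL hη0
    have hr0nn : 0 ≤ r 0 := (hrpos 0).le
    calc a ≤ (1 - (L : ℝ) * η) * r 0 := by rw [hr0]; exact hfirst
      _ ≤ (1 - (j : ℝ) * η) * r 0 := mul_le_mul_of_nonneg_right (by linarith) hr0nn
      _ ≤ (1 - η) ^ j * r 0 := mul_le_mul_of_nonneg_right hbern hr0nn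
      _ ≤ r j := hdecay j hj
  -- (iv) so `F` grows geometrically along the ray
  have hgrow : ∀ j : ℕ, j ≤ L → a ^ j * F x ≤ F (x + j • e) := by
    intro j
    induction j with
    | zero => intro _; simp
    | succ j ih =>
      intro hj
      have ih' := ih (by omega)
      have hrj := hge j hj
      have heq : F (x + (j + 1) • e) = r j * F (x + j • e) := by
        simp only [hr_def]
        rw [div_mul_cancel₀ _ (hF _).ne']
      rw [heq, pow_succ, show a ^ j * a * F x = a * (a ^ j * F x) by ring]
      exact mul_le_mul hrj ih' (mul_nonneg (pow_nonneg ha _) (hF x).le) (hrpos j).le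
  exact hgrow L le_rfl

end Summit.CriticalPhenomena.Ising3DConformalLimit.EnergyNotSigmaSquaredEnergyGapPowerLaw
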